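import Summits.Ventures.GridStability.Models.SMIBPoleSlipK13Range
import Summits.Ventures.GridStability.Models.SMIBAsynchronousRegimeK13
import Literature.MathematicalPhysics.PowerSystems.SMIBGlobalSynchronization

/-!
# GridStability/Models/SMIBK13Corollaries — two honest-framing corollaries for «SMIB-K13post-D10» on TREE objects (lit-1 g7 10:42:49Z offer)

Cell `gridfusion` (LADDER-GRIDFUSION G1.SMIB; lit-1 g7 2026-08-27T10:42:49Z «two optional ≤ 10-line corollaries now available on
TREE objects … lit-1 files nothing under Models/»), seat gridfusion-model-1 (owner of the K13 instance files).
(1) `K13postD10_not_tendsto_of_clearing_ge_0135` — THE UPPER-K ROW AS THE LITERAL NEGATION OF THE LOWER-K SENTENCE FORM: for every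
clearing instant `T ∈ [27/200, 6/25]`, every fault-on motion of `K13fault (10/377)` from the window at rest and every global
post-fault solution `X` of `K13postD10` from the cleared state: `¬ Tendsto X atTop (𝓝 (δˢ, 0))` (lit-1
`SMIB.not_tendsto_sep_of_crossing`, p524536, fed with the crossing time of `K13postD10_poleSlip_of_clearing_ge_0135`, p509597, and
the cleared-angle bound `δ_c ≤ 2.1251 < π − δˢ` from the kernel tube).  Compare #62 «every t_cl ≤ 0.117 s: Tendsto X atTop (𝓝 (δˢ, 0))».
(2) `K13postD10_tendsto_runningProfile` — every post-fault motion that starts above the cosine fence (`ω₀ ≥ 15 + (259753/65625)·cos δ₀`)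
CONVERGES to the running (pole-slipping) regime: `δ → ∞` and `ω − ζ(δ) → 0` for a `2π`-periodic profile `ζ ≥` the fence (lit-1
`SMIB.tendsto_runningProfile_of_cosineFence`, p522007, with the fence facts of `SMIBAsynchronousRegimeK13`, p521538).
THREE COLUMNS: CERTIFIED = theorems about MODEL M′ = classical SMIB «SMIB-K13post-D10» (MV-1 + MV-P + MV-KD); nothing about a machine
or a grid (out-of-step protection trips first).  [cite: AndronovVittKhaikin1966, Ch. VII §3; Kundur1994, §13.1.3 and Example 13.1]
-/

noncomputable section

open Real Set Filter Topology

namespace Summit.Ventures.GridStability.Models.SMIB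

/-- **UPPER-K as a negated convergence (threshold form).**  For every clearing instant `T ∈ [0.135 s, 0.24 s]`, every fault-on motion
`Y` of `K13fault (10/377)` on `[0, T]` from `δ₀ ∈ [0.7290, 0.7291]`, `ω₀ = 0`, and every global post-fault solution `X` of
`K13postD10` with `X 0 = Y T`: `X` does NOT tend to the post-fault equilibrium `(δˢ, 0)`.
[cite: Kundur1994, §13.1.3 and Example 13.1; AndronovVittKhaikin1966, Ch. VII §3] -/
theorem K13postD10_not_tendsto_of_clearing_ge_0135 {T : ℝ} (hT1 : 27 / 200 ≤ T) (hT2 : T ≤ 6 / 25)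
    {Y : ℝ → ℝ × ℝ} (hY : (K13fault (10 / 377)).IsSolutionOn Y (Icc 0 T))
    (hδ0 : (Y 0).1 ∈ Icc (7290 / 10000 : ℝ) (7291 / 10000)) (hω0 : (Y 0).2 = 0)
    {X : ℝ → ℝ × ℝ} (hX0 : X 0 = Y T) (hX : ∀ S : ℝ, K13postD10.IsSolutionOn X (Icc 0 S)) :
    ¬ Tendsto X atTop (𝓝 (deltaK13, 0)) := by
  -- the crossing time from the pole-slip theorem
  obtain ⟨t₁, ht₁, hcross⟩ := K13postD10_poleSlip_of_clearing_ge_0135 hT1 hT2 hY hδ0 hω0 hX0 hX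
  -- the cleared angle is below the u.e.p. (kernel tube at T)
  obtain ⟨hδ, hω⟩ := K13fault_scalar hY
  have hω' : ∀ t ∈ Icc (0 : ℝ) T, HasDerivWithinAt (fun s => (Y s).2)
      ((4303847457 / 88791425 : ℝ) - (10 / 7 : ℝ) * (fun s => (Y s).2) t) (Icc 0 T) t := by
    intro t ht
    refine (hω t ht).congr_deriv ?_
    ring
  obtain ⟨-, -, hδhiT⟩ := SMIBOrbit.faultOn_bounds4 (by norm_num) (by norm_num) hδ hω' hω0 ⟨by linarith, le_rfl⟩
  have hδ02 := hδ0.2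
  have hδc_hi : (Y T).1 ≤ 21251 / 10000 := by
    refine le_trans hδhiT ?_
    have hT2sq : T ^ 2 ≤ (6 / 25 : ℝ) ^ 2 := pow_le_pow_left₀ (by linarith) hT2 2
    norm_num at hδ02 hT2sq ⊢; nlinarith
  -- the literature record
  set p := K13postD10.toLit with hp
  have hpv : p = ⟨7 / 377, 10 / 377, 79912287 / 88791425, 689 / 625⟩ := K13postD10_toLit
  have hM : 0 < p.M := by rw [hpv]; norm_num
  have hD : 0 ≤ p.D := by rw [hpv]; norm_num
  have hPmax : 0 < p.Pmax := by rw [hpv]; norm_num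
  have heq : p.IsEquilibriumAngle deltaK13 :=
    (toLit_isEquilibriumAngle_iff K13postD10_γ deltaK13).2 K13postD10_isEquilibrium
  have hXlit : ∀ S : ℝ, ∀ t ∈ Icc 0 S, HasDerivWithinAt X (p.vectorField (X t)) (Icc 0 S) t :=
    fun S => (isSolutionOn_iff_toLit K13postD10_γ X _).1 (hX S)
  have hδs_hi := deltaK13_lt
  have hπlo := Real.pi_gt_d6
  have hδ0' : (X 0).1 ≤ π - deltaK13 := by
    rw [hX0]; norm_num at hδs_hi hδc_hi hπlo ⊢; linarith
  have hδ1 : π - deltaK13 < (X t₁).1 := by linarith [deltaK13_pos]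
  exact p.not_tendsto_sep_of_crossing hM hD hPmax heq deltaK13_pos deltaK13_lt_pi_div_two hXlit hδ0' ht₁ hδ1

/-- **Convergence TO the running regime above the fence.**  Every global post-fault motion of `K13postD10` whose initial state lies
on or above the cosine fence `ω₀ ≥ 15 + (259753/65625)·cos δ₀` converges to the asynchronous (pole-slipping) regime: the angle tends
to `+∞` and the speed deviation approaches a `2π`-periodic running profile `ζ(δ) ≥ 15 + (259753/65625) cos δ` (so `ω ≥ 11.04 rad/s`
asymptotically along the profile). [cite: AndronovVittKhaikin1966, Ch. VII §3 case II] -/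
theorem K13postD10_tendsto_runningProfile {X : ℝ → ℝ × ℝ} (hX : ∀ S : ℝ, K13postD10.IsSolutionOn X (Icc 0 S))
    (h0 : 15 + (259753 / 65625 : ℝ) * Real.cos (X 0).1 ≤ (X 0).2) :
    ∃ ζ : ℝ → ℝ, (∀ θ, HasDerivAt ζ (K13postD10.toLit.accel θ (ζ θ) / ζ θ) θ) ∧ (∀ θ, ζ (θ + 2 * π) = ζ θ) ∧
      (∀ θ, 15 + (259753 / 65625 : ℝ) * Real.cos θ ≤ ζ θ) ∧
      Tendsto (fun t => (X t).1) atTop atTop ∧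
      Tendsto (fun t => (X t).2 - ζ (X t).1) atTop (𝓝 0) := by
  have hM : 0 < K13postD10.toLit.M := by rw [K13postD10_toLit]; norm_num
  have hD : 0 < K13postD10.toLit.D := by rw [K13postD10_toLit]; norm_num
  have hXlit : ∀ S : ℝ, ∀ t ∈ Icc 0 S, HasDerivWithinAt X (K13postD10.toLit.vectorField (X t)) (Icc 0 S) t :=
    fun S => (isSolutionOn_iff_toLit K13postD10_γ X _).1 (hX S)
  exact K13postD10.toLit.tendsto_runningProfile_of_cosineFence hM hD (a := 15) (b := 259753 / 65625)
    (by norm_num) (by norm_num) K13postD10_fence_product K13postD10_fence_inequality hXlit h0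

end Summit.Ventures.GridStability.Models.SMIB

end
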